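import Mathlib
import Summits.NavierStokesRegularity.NavierStokesRegularity.Theorems.FrozenSignCascadeEnvelopeBoundTimeDeriv
import HarnessLib

/-!
# Route FrozenSignCascade · crux `EnvelopeBound` (stmt-NavierStokesRegularity-1549):
  differentiation of the weighted quadratic functionals of a Fourier-side mild solution

Support file for the crux item stmt-NavierStokesRegularity-1549 (`EnvelopeBound`, route
`FrozenSignCascade`, line `registered`, lead c3); lands `--supports` that item. Second half of
the calculus layer of Leray's energy/enstrophy mechanism for general Fourier-side mild solutions
(`FourierNS.IsFourierMild c K₀ t₀ t₁ V`), on top of `…EnvelopeBoundTimeDeriv` (mild ⇒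
differential, continuity of the functionals):

* `hasDerivAt_weightedSq`: for a continuous weight `w` with `|w(ξ)| ≤ (1+‖ξ‖)^m` and an interior
  time, `d/dt ∫ w ∑ₗ ‖Vₗ‖² = ∫ w(ξ) ∑ₗ (-2c‖ξ‖² ‖Vₗ‖² − 2 Re(conj(Vₗ) N(V,V)ₗ))`
  (differentiation under the integral sign, `hasDerivAt_integral_of_dominated_loc_of_deriv_le`,
  domination `norm_weightedDeriv_le` from the decay of every order uniformly in time);
* `hasDerivAt_energy` (`w = 1`) and `hasDerivAt_enstrophy` (`w = ‖ξ‖²`):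
  `E' = -2c·Ens − 2∫∑ₗRe(conj Vₗ Nₗ)`, `Ens' = -2c·D − 2∫‖ξ‖²∑ₗRe(conj Vₗ Nₗ)` with
  `E = ∫∑‖Vₗ‖²`, `Ens = ∫‖ξ‖²∑‖Vₗ‖²`, `D = ∫‖ξ‖⁴∑‖Vₗ‖²`, the pairing densities being integrable.

The cancellation `∫∑ₗRe(conj Vₗ Nₗ) = 0` (energy identity) and the bound of the enstrophy
production are separate files.

References: J. Leray, Acta Math. 63 (1934) §§19–22; P. G. Lemarié-Rieusset, *The Navier–Stokes
problem in the 21st century* (2016), §7.3, §8.5.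
-/

noncomputable section

set_option linter.dupNamespace false -- nested layout Summit.<S>.<Sub>, Sub = S (D-0017)

open Set MeasureTheory Filter Topology Real
open scoped ComplexConjugate InnerProductSpace
open Literature.Analysis.FluidPDE Literature.Analysis.FluidPDE.FourierNS

namespace Summit.NavierStokesRegularity.NavierStokesRegularity.Theorems.EnvelopeBound.Leray

variable {ι : Type*} [Fintype ι] [DecidableEq ι]
variable {c t₀ t₁ : ℝ} {K₀ : ℕ} {V : ℝ → EuclideanSpace ℝ ι → ι → ℂ}

/-! ### Weighted quadratic functionals: differentiation under the integral sign -/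

/-- **Pointwise domination of the derivative density.** With `|w(ξ)| ≤ (1+‖ξ‖)^m`, decay of
order `m + 2 + K₀` (constant `A`) for all slices and the uniform bound
`‖N(V(r),V(r))(ξ)‖ ≤ C ‖ξ‖ (1+‖ξ‖)^{-K₀}`, the derivative density
`w(ξ) ∑ₗ (-2c‖ξ‖²‖Vₗ‖² − 2 Re(conj(Vₗ) Nₗ))` is bounded by
`card ι · (2|c|A² + 2AC) · (1+‖ξ‖)^{-K₀}`. -/
theorem norm_weightedDeriv_le {w : EuclideanSpace ℝ ι → ℝ} {m : ℕ}
    (hwb : ∀ ξ, |w ξ| ≤ (1 + ‖ξ‖) ^ m) {A : ℝ} (hA : ∀ r, HasDecay (m + 2 + K₀) A (V r))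
    {C : ℝ} (hC0 : 0 ≤ C)
    (hC : ∀ r ξ, ‖nonlin (V r) (V r) ξ‖ ≤ C * ‖ξ‖ * ((1 + ‖ξ‖) ^ K₀)⁻¹)
    (r : ℝ) (ξ : EuclideanSpace ℝ ι) :
    ‖w ξ * ∑ l, (-(2 * c) * (‖ξ‖ ^ 2 * ‖V r ξ l‖ ^ 2) -
        2 * (conj (V r ξ l) * nonlin (V r) (V r) ξ l).re)‖ ≤
      Fintype.card ι * (2 * |c| * A ^ 2 + 2 * A * C) * ((1 + ‖ξ‖) ^ K₀)⁻¹ := by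
  have hA0 : 0 ≤ A := (hA r).nonneg
  have hw : 0 < 1 + ‖ξ‖ := by positivity
  set W : ℝ := ((1 + ‖ξ‖) ^ K₀)⁻¹ with hW
  have hW0 : 0 ≤ W := by positivity
  have hVK : ‖V r ξ‖ ≤ A * ((1 + ‖ξ‖) ^ (m + 2 + K₀))⁻¹ := hA r ξ
  have hVA : ‖V r ξ‖ ≤ A := (hA r).norm_le ξ
  have hN : ‖nonlin (V r) (V r) ξ‖ ≤ C * ‖ξ‖ * W := hC r ξ
  -- each component term
  have hterm : ∀ l, ‖-(2 * c) * (‖ξ‖ ^ 2 * ‖V r ξ l‖ ^ 2) -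
      2 * (conj (V r ξ l) * nonlin (V r) (V r) ξ l).re‖ ≤
      2 * |c| * (‖ξ‖ ^ 2 * ‖V r ξ‖ ^ 2) + 2 * (‖V r ξ‖ * ‖nonlin (V r) (V r) ξ‖) := by
    intro l
    have h1 : ‖V r ξ l‖ ≤ ‖V r ξ‖ := norm_le_pi_norm _ l
    have h2 : ‖nonlin (V r) (V r) ξ l‖ ≤ ‖nonlin (V r) (V r) ξ‖ := norm_le_pi_norm _ l
    have hre : |(conj (V r ξ l) * nonlin (V r) (V r) ξ l).re| ≤
        ‖V r ξ‖ * ‖nonlin (V r) (V r) ξ‖ := by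
      calc |(conj (V r ξ l) * nonlin (V r) (V r) ξ l).re|
          ≤ ‖conj (V r ξ l) * nonlin (V r) (V r) ξ l‖ := Complex.abs_re_le_norm _
        _ = ‖V r ξ l‖ * ‖nonlin (V r) (V r) ξ l‖ := by rw [norm_mul, Complex.norm_conj]
        _ ≤ ‖V r ξ‖ * ‖nonlin (V r) (V r) ξ‖ :=
            mul_le_mul h1 h2 (norm_nonneg _) (norm_nonneg _)
    have hsq : ‖V r ξ l‖ ^ 2 ≤ ‖V r ξ‖ ^ 2 := pow_le_pow_left₀ (norm_nonneg _) h1 2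
    have e1 : ‖-(2 * c) * (‖ξ‖ ^ 2 * ‖V r ξ l‖ ^ 2)‖ = 2 * |c| * (‖ξ‖ ^ 2 * ‖V r ξ l‖ ^ 2) := by
      rw [norm_mul, norm_neg, norm_mul, Real.norm_of_nonneg (by norm_num : (0:ℝ) ≤ 2),
        Real.norm_eq_abs, Real.norm_of_nonneg (by positivity : (0:ℝ) ≤ ‖ξ‖ ^ 2 * ‖V r ξ l‖ ^ 2)]
    have e2 : ‖2 * (conj (V r ξ l) * nonlin (V r) (V r) ξ l).re‖ =
        2 * |(conj (V r ξ l) * nonlin (V r) (V r) ξ l).re| := by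
      rw [norm_mul, Real.norm_of_nonneg (by norm_num : (0:ℝ) ≤ 2), Real.norm_eq_abs]
    calc ‖-(2 * c) * (‖ξ‖ ^ 2 * ‖V r ξ l‖ ^ 2) - 2 * (conj (V r ξ l) * nonlin (V r) (V r) ξ l).re‖
        ≤ ‖-(2 * c) * (‖ξ‖ ^ 2 * ‖V r ξ l‖ ^ 2)‖ +
            ‖2 * (conj (V r ξ l) * nonlin (V r) (V r) ξ l).re‖ := norm_sub_le _ _
      _ = 2 * |c| * (‖ξ‖ ^ 2 * ‖V r ξ l‖ ^ 2) +
            2 * |(conj (V r ξ l) * nonlin (V r) (V r) ξ l).re| := by rw [e1, e2]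
      _ ≤ 2 * |c| * (‖ξ‖ ^ 2 * ‖V r ξ‖ ^ 2) + 2 * (‖V r ξ‖ * ‖nonlin (V r) (V r) ξ‖) := by
          gcongr
  -- sum over components and multiply by the weight
  have hsum : ‖∑ l, (-(2 * c) * (‖ξ‖ ^ 2 * ‖V r ξ l‖ ^ 2) -
      2 * (conj (V r ξ l) * nonlin (V r) (V r) ξ l).re)‖ ≤
      Fintype.card ι * (2 * |c| * (‖ξ‖ ^ 2 * ‖V r ξ‖ ^ 2) +
        2 * (‖V r ξ‖ * ‖nonlin (V r) (V r) ξ‖)) := by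
    calc _ ≤ ∑ l, ‖-(2 * c) * (‖ξ‖ ^ 2 * ‖V r ξ l‖ ^ 2) -
          2 * (conj (V r ξ l) * nonlin (V r) (V r) ξ l).re‖ := norm_sum_le _ _
      _ ≤ ∑ _l : ι, (2 * |c| * (‖ξ‖ ^ 2 * ‖V r ξ‖ ^ 2) +
          2 * (‖V r ξ‖ * ‖nonlin (V r) (V r) ξ‖)) := Finset.sum_le_sum fun l _ => hterm l
      _ = _ := by rw [Finset.sum_const, Finset.card_univ, nsmul_eq_mul]
  -- the two weight estimates
  have hx1 : (1 + ‖ξ‖) ^ m * (‖ξ‖ ^ 2 * ‖V r ξ‖ ^ 2) ≤ A ^ 2 * W := by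
    have hξ2 : ‖ξ‖ ^ 2 ≤ (1 + ‖ξ‖) ^ 2 :=
      pow_le_pow_left₀ (norm_nonneg _) (by linarith [norm_nonneg ξ]) 2
    have hVV : ‖V r ξ‖ ^ 2 ≤ A * ((1 + ‖ξ‖) ^ (m + 2 + K₀))⁻¹ * A := by
      calc ‖V r ξ‖ ^ 2 = ‖V r ξ‖ * ‖V r ξ‖ := sq _
        _ ≤ A * ((1 + ‖ξ‖) ^ (m + 2 + K₀))⁻¹ * A :=
            mul_le_mul hVK hVA (norm_nonneg _) (by positivity)
    calc (1 + ‖ξ‖) ^ m * (‖ξ‖ ^ 2 * ‖V r ξ‖ ^ 2)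
        ≤ (1 + ‖ξ‖) ^ m * ((1 + ‖ξ‖) ^ 2 * (A * ((1 + ‖ξ‖) ^ (m + 2 + K₀))⁻¹ * A)) := by
          gcongr
      _ = A ^ 2 * ((1 + ‖ξ‖) ^ (m + 2) * ((1 + ‖ξ‖) ^ (m + 2 + K₀))⁻¹) := by ring
      _ = A ^ 2 * W := by rw [weight_pow_mul_inv_pow_add]
  have hx2 : (1 + ‖ξ‖) ^ m * (‖V r ξ‖ * ‖nonlin (V r) (V r) ξ‖) ≤ A * C * W := by
    have hξ1 : ‖ξ‖ ≤ (1 + ‖ξ‖) ^ 1 := by rw [pow_one]; linarith [norm_nonneg ξ]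
    have hle1 : (1 + ‖ξ‖) ^ (m + 1) * ((1 + ‖ξ‖) ^ (m + 2 + K₀))⁻¹ ≤ 1 := by
      rw [show m + 2 + K₀ = (m + 1) + (1 + K₀) by ring, weight_pow_mul_inv_pow_add]
      exact inv_one_add_norm_pow_le_one ξ _
    have hNN : ‖nonlin (V r) (V r) ξ‖ ≤ C * (1 + ‖ξ‖) ^ 1 * W := by
      calc ‖nonlin (V r) (V r) ξ‖ ≤ C * ‖ξ‖ * W := hN
        _ ≤ C * (1 + ‖ξ‖) ^ 1 * W := by gcongr
    calc (1 + ‖ξ‖) ^ m * (‖V r ξ‖ * ‖nonlin (V r) (V r) ξ‖)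
        ≤ (1 + ‖ξ‖) ^ m * ((A * ((1 + ‖ξ‖) ^ (m + 2 + K₀))⁻¹) * (C * (1 + ‖ξ‖) ^ 1 * W)) := by
          gcongr
      _ = A * C * W * ((1 + ‖ξ‖) ^ (m + 1) * ((1 + ‖ξ‖) ^ (m + 2 + K₀))⁻¹) := by ring
      _ ≤ A * C * W * 1 := by gcongr
      _ = A * C * W := mul_one _
  rw [norm_mul, Real.norm_eq_abs]
  calc |w ξ| * ‖∑ l, (-(2 * c) * (‖ξ‖ ^ 2 * ‖V r ξ l‖ ^ 2) -
        2 * (conj (V r ξ l) * nonlin (V r) (V r) ξ l).re)‖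
      ≤ (1 + ‖ξ‖) ^ m * (Fintype.card ι * (2 * |c| * (‖ξ‖ ^ 2 * ‖V r ξ‖ ^ 2) +
          2 * (‖V r ξ‖ * ‖nonlin (V r) (V r) ξ‖))) :=
        mul_le_mul (hwb ξ) hsum (norm_nonneg _) (by positivity)
    _ = Fintype.card ι * (2 * |c| * ((1 + ‖ξ‖) ^ m * (‖ξ‖ ^ 2 * ‖V r ξ‖ ^ 2)) +
          2 * ((1 + ‖ξ‖) ^ m * (‖V r ξ‖ * ‖nonlin (V r) (V r) ξ‖))) := by ring
    _ ≤ Fintype.card ι * (2 * |c| * (A ^ 2 * W) + 2 * (A * C * W)) := by gcongr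
    _ = Fintype.card ι * (2 * |c| * A ^ 2 + 2 * A * C) * W := by ring

/-- **Differentiation of weighted quadratic functionals under the integral sign.** For a
Fourier-side mild solution `V` on `[t₀,t₁]`, a continuous weight `w` with `|w(ξ)| ≤ (1+‖ξ‖)^m`
and an interior time `t ∈ (t₀,t₁)`,
`d/dt ∫ w(ξ) ∑ₗ ‖V(t,ξ)ₗ‖² dξ = ∫ w(ξ) ∑ₗ (-2c‖ξ‖² ‖V(t,ξ)ₗ‖² − 2 Re(conj(V(t,ξ)ₗ) N(V,V)(t,ξ)ₗ)) dξ`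
(`hasDerivAt_integral_of_dominated_loc_of_deriv_le` on a ball inside `(t₀,t₁)`, with the
domination `norm_weightedDeriv_le`), and the derivative density is integrable. -/
theorem hasDerivAt_weightedSq (h : IsFourierMild c K₀ t₀ t₁ V) {w : EuclideanSpace ℝ ι → ℝ}
    (hw : Continuous w) {m : ℕ} (hwb : ∀ ξ, |w ξ| ≤ (1 + ‖ξ‖) ^ m) {t : ℝ} (ht : t ∈ Ioo t₀ t₁) :
    Integrable (fun ξ => w ξ * ∑ l, (-(2 * c) * (‖ξ‖ ^ 2 * ‖V t ξ l‖ ^ 2) -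
        2 * (conj (V t ξ l) * nonlin (V t) (V t) ξ l).re)) ∧
    HasDerivAt (fun s => ∫ ξ, w ξ * ∑ l, ‖V s ξ l‖ ^ 2)
      (∫ ξ, w ξ * ∑ l, (-(2 * c) * (‖ξ‖ ^ 2 * ‖V t ξ l‖ ^ 2) -
        2 * (conj (V t ξ l) * nonlin (V t) (V t) ξ l).re)) t := by
  obtain ⟨A, hA⟩ := h.decay (m + 2 + K₀)
  obtain ⟨A', hA'⟩ := h.decay (m + K₀)
  obtain ⟨C, hC0, hC⟩ := h.norm_nonlin_le K₀
  -- measurability of the densities (continuity in `ξ`)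
  have hNc : ∀ s, Continuous fun ξ => nonlin (V s) (V s) ξ := fun s => by
    have : (fun ξ => nonlin (V s) (V s) ξ) =
        (fun p : ℝ × EuclideanSpace ℝ ι => nonlin (V p.1) (V p.1) p.2) ∘ fun ξ => (s, ξ) := rfl
    rw [this]; exact h.continuous_nonlin.comp (by fun_prop)
  have hFm : ∀ s, AEStronglyMeasurable (fun ξ => w ξ * ∑ l, ‖V s ξ l‖ ^ 2) volume :=
    fun s => (hw.mul (continuous_finsetSum _ fun l _ =>
      ((continuous_apply l).comp (h.continuous_slice s)).norm.pow 2)).aestronglyMeasurable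
  have hF'm : ∀ s, AEStronglyMeasurable (fun ξ => w ξ * ∑ l, (-(2 * c) * (‖ξ‖ ^ 2 * ‖V s ξ l‖ ^ 2) -
        2 * (conj (V s ξ l) * nonlin (V s) (V s) ξ l).re)) volume := by
    intro s
    refine (hw.mul (continuous_finsetSum _ fun l _ => ?_)).aestronglyMeasurable
    refine ((continuous_const.mul ((continuous_norm.pow 2).mul
      (((continuous_apply l).comp (h.continuous_slice s)).norm.pow 2))).sub
      (continuous_const.mul (Complex.continuous_re.comp ?_)))
    exact (Complex.continuous_conj.comp ((continuous_apply l).comp (h.continuous_slice s))).mul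
      ((continuous_apply l).comp (hNc s))
  -- integrability of the functional at `t`
  have hFi : Integrable (fun ξ => w ξ * ∑ l, ‖V t ξ l‖ ^ 2) :=
    (((integrable_inv_one_add_norm_pow (finrank_lt_of_card_lt h.hK₀)).const_mul
      (Fintype.card ι * A' ^ 2)).mono' (hFm t)
      (Eventually.of_forall fun ξ => norm_weightedSq_le hwb hA' t ξ))
  -- the pointwise derivative at the times of `(t₀, t₁)`
  have hdiff : ∀ ξ, ∀ x ∈ Ioo t₀ t₁, HasDerivAt (fun s => w ξ * ∑ l, ‖V s ξ l‖ ^ 2)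
      (w ξ * ∑ l, (-(2 * c) * (‖ξ‖ ^ 2 * ‖V x ξ l‖ ^ 2) -
        2 * (conj (V x ξ l) * nonlin (V x) (V x) ξ l).re)) x := by
    intro ξ x hx
    have hderiv := HasDerivAt.sum (u := Finset.univ)
      (A := fun l s => ‖V s ξ l‖ ^ 2) fun l _ => hasDerivAt_normSq_apply h ξ hx l
    have := hderiv.const_mul (w ξ)
    simpa only [Finset.sum_apply] using this
  have hs : Ioo t₀ t₁ ∈ 𝓝 t := Ioo_mem_nhds ht.1 ht.2
  have hbound : ∀ᵐ ξ ∂(volume : Measure (EuclideanSpace ℝ ι)), ∀ x ∈ Ioo t₀ t₁,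
      ‖w ξ * ∑ l, (-(2 * c) * (‖ξ‖ ^ 2 * ‖V x ξ l‖ ^ 2) -
        2 * (conj (V x ξ l) * nonlin (V x) (V x) ξ l).re)‖ ≤
      Fintype.card ι * (2 * |c| * A ^ 2 + 2 * A * C) * ((1 + ‖ξ‖) ^ K₀)⁻¹ :=
    Eventually.of_forall fun ξ x _ => norm_weightedDeriv_le hwb hA hC0 hC x ξ
  have hbi := (integrable_inv_one_add_norm_pow (E := EuclideanSpace ℝ ι)
    (finrank_lt_of_card_lt h.hK₀)).const_mul ((Fintype.card ι : ℝ) * (2 * |c| * A ^ 2 + 2 * A * C))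
  have key := hasDerivAt_integral_of_dominated_loc_of_deriv_le
    (F := fun s ξ => w ξ * ∑ l, ‖V s ξ l‖ ^ 2)
    (F' := fun s ξ => w ξ * ∑ l, (-(2 * c) * (‖ξ‖ ^ 2 * ‖V s ξ l‖ ^ 2) -
        2 * (conj (V s ξ l) * nonlin (V s) (V s) ξ l).re))
    hs (Eventually.of_forall hFm) hFi (hF'm t) hbound hbi
    (Eventually.of_forall fun ξ x hx => hdiff ξ x hx)
  exact key

/-- **The energy derivative**: at interior times,
`d/dt ∫ ∑ₗ ‖V(t,ξ)ₗ‖² dξ = -2c ∫ ‖ξ‖² ∑ₗ ‖V(t,ξ)ₗ‖² dξ − 2 ∫ ∑ₗ Re(conj(V(t,ξ)ₗ) N(V,V)(t,ξ)ₗ) dξ`,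
and the pairing density `∑ₗ Re(conj(Vₗ) Nₗ)` is integrable. -/
theorem hasDerivAt_energy (h : IsFourierMild c K₀ t₀ t₁ V) {t : ℝ} (ht : t ∈ Ioo t₀ t₁) :
    Integrable (fun ξ => ∑ l, (conj (V t ξ l) * nonlin (V t) (V t) ξ l).re) ∧
    HasDerivAt (fun s => ∫ ξ, ∑ l, ‖V s ξ l‖ ^ 2)
      (-(2 * c) * (∫ ξ, ‖ξ‖ ^ 2 * ∑ l, ‖V t ξ l‖ ^ 2) -
        2 * ∫ ξ, ∑ l, (conj (V t ξ l) * nonlin (V t) (V t) ξ l).re) t := by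
  have hw1 : ∀ ξ : EuclideanSpace ℝ ι, |(fun _ => (1 : ℝ)) ξ| ≤ (1 + ‖ξ‖) ^ 0 := fun ξ => by simp
  obtain ⟨hint, hder⟩ := hasDerivAt_weightedSq h (w := fun _ => (1 : ℝ)) continuous_const hw1 ht
  simp only [one_mul] at hint hder
  -- split the integral of the derivative density
  obtain ⟨A, hA⟩ := h.decay (2 + K₀)
  have hi1 : Integrable (fun ξ => ‖ξ‖ ^ 2 * ∑ l, ‖V t ξ l‖ ^ 2) := by
    have hb : ∀ ξ : EuclideanSpace ℝ ι, |‖ξ‖ ^ 2| ≤ (1 + ‖ξ‖) ^ 2 := fun ξ => by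
      rw [abs_of_nonneg (sq_nonneg _)]
      exact pow_le_pow_left₀ (norm_nonneg _) (by linarith [norm_nonneg ξ]) 2
    exact (((integrable_inv_one_add_norm_pow (finrank_lt_of_card_lt h.hK₀)).const_mul
      (Fintype.card ι * A ^ 2)).mono'
      (((continuous_norm.pow 2).mul (continuous_finsetSum _ fun l _ =>
        ((continuous_apply l).comp (h.continuous_slice t)).norm.pow 2)).aestronglyMeasurable)
      (Eventually.of_forall fun ξ => norm_weightedSq_le hb hA t ξ))
  have hi1' : Integrable (fun ξ => ∑ l, (-(2 * c) * (‖ξ‖ ^ 2 * ‖V t ξ l‖ ^ 2))) := by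
    have : (fun ξ : EuclideanSpace ℝ ι => ∑ l, (-(2 * c) * (‖ξ‖ ^ 2 * ‖V t ξ l‖ ^ 2))) =
        fun ξ => -(2 * c) * (‖ξ‖ ^ 2 * ∑ l, ‖V t ξ l‖ ^ 2) := by
      funext ξ; simp only [Finset.mul_sum]
    rw [this]; exact hi1.const_mul _
  have hi2 : Integrable (fun ξ => ∑ l, (2 * (conj (V t ξ l) * nonlin (V t) (V t) ξ l).re)) := by
    have heq : (fun ξ => ∑ l, (2 * (conj (V t ξ l) * nonlin (V t) (V t) ξ l).re)) =
        fun ξ => ∑ l, (-(2 * c) * (‖ξ‖ ^ 2 * ‖V t ξ l‖ ^ 2)) -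
          ∑ l, (-(2 * c) * (‖ξ‖ ^ 2 * ‖V t ξ l‖ ^ 2) -
            2 * (conj (V t ξ l) * nonlin (V t) (V t) ξ l).re) := by
      funext ξ; rw [← Finset.sum_sub_distrib]
      refine Finset.sum_congr rfl fun l _ => ?_; ring
    rw [heq]; exact hi1'.sub hint
  have hi2' : Integrable (fun ξ => ∑ l, (conj (V t ξ l) * nonlin (V t) (V t) ξ l).re) := by
    have heq : (fun ξ => ∑ l, (conj (V t ξ l) * nonlin (V t) (V t) ξ l).re) =
        fun ξ => (2 : ℝ)⁻¹ * ∑ l, (2 * (conj (V t ξ l) * nonlin (V t) (V t) ξ l).re) := by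
      funext ξ; simp only [Finset.mul_sum]
      exact Finset.sum_congr rfl fun l _ => by ring
    rw [heq]; exact hi2.const_mul _
  refine ⟨hi2', ?_⟩
  have hsplit : (∫ ξ, ∑ l, (-(2 * c) * (‖ξ‖ ^ 2 * ‖V t ξ l‖ ^ 2) -
      2 * (conj (V t ξ l) * nonlin (V t) (V t) ξ l).re)) =
      -(2 * c) * (∫ ξ, ‖ξ‖ ^ 2 * ∑ l, ‖V t ξ l‖ ^ 2) -
        2 * ∫ ξ, ∑ l, (conj (V t ξ l) * nonlin (V t) (V t) ξ l).re := by
    have e1 : (fun ξ => ∑ l, (-(2 * c) * (‖ξ‖ ^ 2 * ‖V t ξ l‖ ^ 2) -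
        2 * (conj (V t ξ l) * nonlin (V t) (V t) ξ l).re)) =
        fun ξ => ∑ l, (-(2 * c) * (‖ξ‖ ^ 2 * ‖V t ξ l‖ ^ 2)) -
          ∑ l, (2 * (conj (V t ξ l) * nonlin (V t) (V t) ξ l).re) := by
      funext ξ; rw [← Finset.sum_sub_distrib]
    rw [e1, integral_sub hi1' hi2]
    congr 1
    · rw [← integral_const_mul]
      congr 1; funext ξ; simp only [Finset.mul_sum]
    · rw [← integral_const_mul]
      congr 1; funext ξ; simp only [Finset.mul_sum]
  rw [hsplit] at hder
  exact hder

/-- **The enstrophy derivative**: at interior times,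
`d/dt ∫ ‖ξ‖² ∑ₗ ‖V(t,ξ)ₗ‖² dξ = -2c ∫ ‖ξ‖⁴ ∑ₗ ‖V(t,ξ)ₗ‖² dξ − 2 ∫ ‖ξ‖² ∑ₗ Re(conj(V(t,ξ)ₗ) N(V,V)(t,ξ)ₗ) dξ`,
and the weighted pairing density is integrable. -/
theorem hasDerivAt_enstrophy (h : IsFourierMild c K₀ t₀ t₁ V) {t : ℝ} (ht : t ∈ Ioo t₀ t₁) :
    Integrable (fun ξ => ‖ξ‖ ^ 2 * ∑ l, (conj (V t ξ l) * nonlin (V t) (V t) ξ l).re) ∧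
    HasDerivAt (fun s => ∫ ξ, ‖ξ‖ ^ 2 * ∑ l, ‖V s ξ l‖ ^ 2)
      (-(2 * c) * (∫ ξ, ‖ξ‖ ^ 4 * ∑ l, ‖V t ξ l‖ ^ 2) -
        2 * ∫ ξ, ‖ξ‖ ^ 2 * ∑ l, (conj (V t ξ l) * nonlin (V t) (V t) ξ l).re) t := by
  have hw2 : ∀ ξ : EuclideanSpace ℝ ι, |‖ξ‖ ^ 2| ≤ (1 + ‖ξ‖) ^ 2 := fun ξ => by
    rw [abs_of_nonneg (sq_nonneg _)]
    exact pow_le_pow_left₀ (norm_nonneg _) (by linarith [norm_nonneg ξ]) 2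
  obtain ⟨hint, hder⟩ := hasDerivAt_weightedSq h (w := fun ξ => ‖ξ‖ ^ 2) (continuous_norm.pow 2) hw2 ht
  -- split the integral of the derivative density
  obtain ⟨A, hA⟩ := h.decay (4 + K₀)
  have hi1 : Integrable (fun ξ => ‖ξ‖ ^ 4 * ∑ l, ‖V t ξ l‖ ^ 2) := by
    have hb : ∀ ξ : EuclideanSpace ℝ ι, |‖ξ‖ ^ 4| ≤ (1 + ‖ξ‖) ^ 4 := fun ξ => by
      rw [abs_of_nonneg (by positivity)]
      exact pow_le_pow_left₀ (norm_nonneg _) (by linarith [norm_nonneg ξ]) 4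
    exact (((integrable_inv_one_add_norm_pow (finrank_lt_of_card_lt h.hK₀)).const_mul
      (Fintype.card ι * A ^ 2)).mono'
      (((continuous_norm.pow 4).mul (continuous_finsetSum _ fun l _ =>
        ((continuous_apply l).comp (h.continuous_slice t)).norm.pow 2)).aestronglyMeasurable)
      (Eventually.of_forall fun ξ => norm_weightedSq_le hb hA t ξ))
  have hi1' : Integrable (fun ξ => ‖ξ‖ ^ 2 * ∑ l, (-(2 * c) * (‖ξ‖ ^ 2 * ‖V t ξ l‖ ^ 2))) := by
    have : (fun ξ : EuclideanSpace ℝ ι => ‖ξ‖ ^ 2 * ∑ l, (-(2 * c) * (‖ξ‖ ^ 2 * ‖V t ξ l‖ ^ 2))) =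
        fun ξ => -(2 * c) * (‖ξ‖ ^ 4 * ∑ l, ‖V t ξ l‖ ^ 2) := by
      funext ξ; simp only [Finset.mul_sum]
      exact Finset.sum_congr rfl fun l _ => by ring
    rw [this]; exact hi1.const_mul _
  have hi2 : Integrable (fun ξ => ‖ξ‖ ^ 2 *
      ∑ l, (2 * (conj (V t ξ l) * nonlin (V t) (V t) ξ l).re)) := by
    have heq : (fun ξ => ‖ξ‖ ^ 2 * ∑ l, (2 * (conj (V t ξ l) * nonlin (V t) (V t) ξ l).re)) =
        fun ξ => ‖ξ‖ ^ 2 * ∑ l, (-(2 * c) * (‖ξ‖ ^ 2 * ‖V t ξ l‖ ^ 2)) -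
          ‖ξ‖ ^ 2 * ∑ l, (-(2 * c) * (‖ξ‖ ^ 2 * ‖V t ξ l‖ ^ 2) -
            2 * (conj (V t ξ l) * nonlin (V t) (V t) ξ l).re) := by
      funext ξ; rw [← mul_sub, ← Finset.sum_sub_distrib]; congr 1
      refine Finset.sum_congr rfl fun l _ => ?_; ring
    rw [heq]; exact hi1'.sub hint
  have hi2' : Integrable (fun ξ => ‖ξ‖ ^ 2 * ∑ l, (conj (V t ξ l) * nonlin (V t) (V t) ξ l).re) := by
    have heq : (fun ξ => ‖ξ‖ ^ 2 * ∑ l, (conj (V t ξ l) * nonlin (V t) (V t) ξ l).re) =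
        fun ξ => (2 : ℝ)⁻¹ * (‖ξ‖ ^ 2 *
          ∑ l, (2 * (conj (V t ξ l) * nonlin (V t) (V t) ξ l).re)) := by
      funext ξ; simp only [Finset.mul_sum]
      exact Finset.sum_congr rfl fun l _ => by ring
    rw [heq]; exact hi2.const_mul _
  refine ⟨hi2', ?_⟩
  have hsplit : (∫ ξ, ‖ξ‖ ^ 2 * ∑ l, (-(2 * c) * (‖ξ‖ ^ 2 * ‖V t ξ l‖ ^ 2) -
      2 * (conj (V t ξ l) * nonlin (V t) (V t) ξ l).re)) =
      -(2 * c) * (∫ ξ, ‖ξ‖ ^ 4 * ∑ l, ‖V t ξ l‖ ^ 2) -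
        2 * ∫ ξ, ‖ξ‖ ^ 2 * ∑ l, (conj (V t ξ l) * nonlin (V t) (V t) ξ l).re := by
    have e1 : (fun ξ => ‖ξ‖ ^ 2 * ∑ l, (-(2 * c) * (‖ξ‖ ^ 2 * ‖V t ξ l‖ ^ 2) -
        2 * (conj (V t ξ l) * nonlin (V t) (V t) ξ l).re)) =
        fun ξ => ‖ξ‖ ^ 2 * ∑ l, (-(2 * c) * (‖ξ‖ ^ 2 * ‖V t ξ l‖ ^ 2)) -
          ‖ξ‖ ^ 2 * ∑ l, (2 * (conj (V t ξ l) * nonlin (V t) (V t) ξ l).re) := by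
      funext ξ; rw [← mul_sub, ← Finset.sum_sub_distrib]
    rw [e1, integral_sub hi1' hi2]
    congr 1
    · rw [← integral_const_mul]
      congr 1; funext ξ
      simp only [Finset.mul_sum]
      exact Finset.sum_congr rfl fun l _ => by ring
    · rw [← integral_const_mul]
      congr 1; funext ξ; simp only [Finset.mul_sum]
      exact Finset.sum_congr rfl fun l _ => by ring
  rw [hsplit] at hder
  exact hder

/-! ### Registered forms (dimension three, all binders explicit) -/

/-- **The energy derivative on `ℝ³` (registered support statement of the crux item).** -/
theorem hasDerivAt_energy_fin3 :
    ∀ (c : ℝ) (K₀ : ℕ) (t₀ t₁ : ℝ) (V : ℝ → EuclideanSpace ℝ (Fin 3) → Fin 3 → ℂ),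
      Literature.Analysis.FluidPDE.FourierNS.IsFourierMild c K₀ t₀ t₁ V →
      ∀ t ∈ Set.Ioo t₀ t₁,
        HasDerivAt (fun s => ∫ ξ, ∑ l, ‖V s ξ l‖ ^ 2)
          (-(2 * c) * (∫ ξ, ‖ξ‖ ^ 2 * ∑ l, ‖V t ξ l‖ ^ 2) -
            2 * ∫ ξ, ∑ l, ((starRingEnd ℂ) (V t ξ l) *
              Literature.Analysis.FluidPDE.FourierNS.nonlin (V t) (V t) ξ l).re) t :=
  fun _ _ _ _ _ h _ ht => (hasDerivAt_energy h ht).2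

/-- **The enstrophy derivative on `ℝ³` (registered support statement of the crux item).** -/
theorem hasDerivAt_enstrophy_fin3 :
    ∀ (c : ℝ) (K₀ : ℕ) (t₀ t₁ : ℝ) (V : ℝ → EuclideanSpace ℝ (Fin 3) → Fin 3 → ℂ),
      Literature.Analysis.FluidPDE.FourierNS.IsFourierMild c K₀ t₀ t₁ V →
      ∀ t ∈ Set.Ioo t₀ t₁,
        HasDerivAt (fun s => ∫ ξ, ‖ξ‖ ^ 2 * ∑ l, ‖V s ξ l‖ ^ 2)
          (-(2 * c) * (∫ ξ, ‖ξ‖ ^ 4 * ∑ l, ‖V t ξ l‖ ^ 2) -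
            2 * ∫ ξ, ‖ξ‖ ^ 2 * ∑ l, ((starRingEnd ℂ) (V t ξ l) *
              Literature.Analysis.FluidPDE.FourierNS.nonlin (V t) (V t) ξ l).re) t :=
  fun _ _ _ _ _ h _ ht => (hasDerivAt_enstrophy h ht).2

end Summit.NavierStokesRegularity.NavierStokesRegularity.Theorems.EnvelopeBound.Leray

end
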